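import Mathlib
import HarnessLib
import Summits.HubbardSuperconductivity.HubbardSuperconductivity.Theorems.KLProgrammeKLRegimeEngineTowerLevStepLinkUniformFKlEng
import Summits.HubbardSuperconductivity.HubbardSuperconductivity.Theorems.KLProgrammeKLRegimeEngineTowerPartialIncrLevStepF

/-!
# Route `KLProgramme` — crux K3 ENGINE (stmt-HubbardSuperconductivity-20437 `KLRegimeEngineV17F2`), stub (b) v2, THE LEVELS PACKAGE (ℓ), located item
# «(ℓ)-READOUT-F» piece (RO-2), layer (e′): the PARTIAL-BLOCK data discharged on the flow frame `K_n` and the floor-keyed partial step composed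
# (cell gate-hubbard-kl, seat hubbard-kl-k3c2-p3 g14; twin of this seat's `linkDataF_klEng` / `levLawF_hstep_klEng` (…TowerLevStepLinkUniformFKlEng) for the slice
#  `(Λ_j, Λ_{dk}]`, `dk ≤ j ≤ d(k+1)` — at `j = d(k+1)` it IS the block's bundle, with the SAME constants `Cκ Cb CJ`)

WHY.  RO-2's model half (`partialIncrLevF_le_kitStep_of_bounds`, …TowerPartialIncrLevStepF) leaves the partial slice's Gram / decay / overlap data as hypotheses under
four k-free bounds.  The doors in the tree are already partial-slice-generic: `gram_sliceCT_bgmFat_sharp_klEng` (any `Λ ≤ Λ′ ≤ Λ_{m+1}`),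
`TorusFourierL2.alphaWt_blockSliceCT_bgmFat_klEng_flow_all'` (fat family `nf = dk − 1`, lower scale `J₂ = j ∈ [dk, dk + d]`), `overlapWt_towerBlock_klEng_flow_all`
(one family step `E(F_{dk})·S(F̃_{dk−1})`).  This file bundles them per `(k, j)` and composes:

* §1 **`linkDataPartialF_klEng`** — the eight data of the slice `(Λ_j, Λ_{dk}]` sandwiched by `S(F̃_{dk−1})`: `κ_k = √(Cκ·(Λ_{dk}/Λ_{dk−1})·e₀·8^{−(dk−1)})` (positive,
  `κ_k²·8^{dk} ≤ (√(2Cκe₀))²`, `IsGramBoundedR`), UNWEIGHTED rows/cols `≤ α_j = Cb·(M/β)/Λ_j ≤ (Cb·(M/β)·4^d/e₀)·4^{dk}`, analysis-overlap rows/cols `≤ 81·CJ·M/β`,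
  `≤ 162·CJ·M/β` — uniformly in `j ∈ [dk, d(k+1)]`;
* §2 **`partialIncrLevF_le_kitStep_klEng`** — the floor-keyed partial step on `K_n` with these data discharged (parameters pinned by equations).
* §3 **`linkDataPartialF_klEng'`, `partialIncrLevF_le_kitStep_klEng'`** — the same two with the binder `d·(k+1) ≤ n_β + 1` replaced by `j ≤ n_β + 1`
  (it only fed the alpha door's `J₂ ≤ n_β + 1`), so that the top partial block is covered and ONE instance serves the law's blocks (`j := d(k+1)`) and the
  born partial step under the same `Cκ Cb CJ` (appended by k3c3-p2 g16).
Compositions of landed theorems; nothing about the model is asserted beyond them; nothing asserts (ℓ), any stub, K3 or superconductivity.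
References: BGM 2006 §2.7 (2.71a), §2.8 (2.76)–(2.84), (2.97)–(2.98), §3 (3.2)–(3.8) [cite: BenfattoGiulianiMastropietro2006].
-/

noncomputable section

namespace Summit.HubbardSuperconductivity.HubbardSuperconductivity.Theorems.EngineV8

set_option linter.dupNamespace false -- summit = problem name (single-conjunct summit), D-0017

open Classical
open Real Finset Literature.MathematicalPhysics.QuantumLattice Literature.Probability.LatticeModels GrassmannAlgebra
open Literature.MathematicalPhysics.QuantumLattice.FermiRG Literature.MathematicalPhysics.QuantumLattice.FermiRG.BGM2006Routing
open Summit.HubbardSuperconductivity.HubbardSuperconductivity.Theorems.KLProgrammeLegKernels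
open Summit.HubbardSuperconductivity.HubbardSuperconductivity.Theorems.KLRegimeSplit
open Summit.HubbardSuperconductivity.HubbardSuperconductivity.Theorems.KLRegimeWick
open Summit.HubbardSuperconductivity.HubbardSuperconductivity.Theorems.TwoPointAssembly
open Summit.HubbardSuperconductivity.HubbardSuperconductivity.Theorems.DispersionFlow
open Summit.HubbardSuperconductivity.HubbardSuperconductivity.Theorems.TorusFourierL2

variable {L M : ℕ} [NeZero L] [NeZero M]

/-! ## §1 The partial-slice data as a bundle -/

/-- **THE PARTIAL SLICE's DATA ON THE FLOW FRAME, FROM THE MODEL, AS ONE BUNDLE** — for every block `k ≥ 1` with `2 ≤ dk`, `d(k+1) ≤ n_β+1`, `dk ≤ n` and every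
`j` with `dk ≤ j ≤ d(k+1)`: the Gram constant `κ_k` of the fat-sandwiched partial slice `S(F̃_{dk−1})ᵀ C^{K_n}_{(Λ_j, Λ_{dk}]} S(F̃_{dk−1})` (positive, k-free form
`κ_k²·8^{dk} ≤ (√(2Cκe₀))²`, `IsGramBoundedR`), its UNWEIGHTED rows/cols `≤ α_j = Cb·(M/β)/Λ_j ≤ (Cb·(M/β)·4^d/e₀)·4^{dk}`, and the UNWEIGHTED analysis-overlap
rows/cols of `E(F_{dk})·S(F̃_{dk−1})` `≤ 81·CJ·M/β`, `≤ 162·CJ·M/β` — the statement of `linkDataF_klEng` with the partial slice (at `j = d(k+1)` verbatim).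
[cite: BenfattoGiulianiMastropietro2006, §2.7 (2.71a), §2.8 (2.77), (2.81)-(2.83)] -/
theorem linkDataPartialF_klEng (d : ℕ) (R : RenConsts) (c'' : ℝ) (hc'' : 0 < c'') :
    ∃ Cκ Cb CJ : ℝ, 0 < Cκ ∧ 0 < Cb ∧ 0 < CJ ∧
      ∀ (G : GeoConsts) (P : SplitConsts) (Q : EngConsts) (c : ℝ), P.WF → R.WF2 → 0 < c → c ≤ klEngC₃6 P R →
      ∀ μ ∈ klWindowC, ∀ U : ℝ, 0 < U → U ≤ klEngU₀9 P R c → c'' * U ≤ 1 →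
      ∀ β : ℝ, klBetaMin ≤ β → β ≤ Real.exp (c / U ^ 2) →
      ∀ (L M : ℕ) [NeZero L] [NeZero M], klEngL₃ β U ≤ L → klEngM₃ β U L ≤ M →
      ∀ n : ℕ, 1 ≤ n → n ≤ nScales β + 1 → IsKLRegime U c (-(n : ℤ)) →
        HistP klPredsV17F2 L M G P Q R β U μ 0 n → FrameOK R U (nScales β) μ (klFlowFrameU L M β U μ n) →
        (∀ m, 1 ≤ m → m < n → FlowPieceOscAt L M c'' β U μ m) →
      ∀ k : ℕ, 1 ≤ k → 2 ≤ d * k → d * (k + 1) ≤ nScales β + 1 → d * k ≤ n → ∀ j : ℕ, d * k ≤ j → j ≤ d * (k + 1) →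
        0 < Real.sqrt (Cκ * (klScale klE0 (d * k) / klScale klE0 (d * k - 1)) * (klE0 * ((8 : ℝ) ^ (d * k - 1))⁻¹)) ∧
        Real.sqrt (Cκ * (klScale klE0 (d * k) / klScale klE0 (d * k - 1)) * (klE0 * ((8 : ℝ) ^ (d * k - 1))⁻¹)) ^ 2 * (8 : ℝ) ^ (d * k) ≤ Real.sqrt (2 * Cκ * klE0) ^ 2 ∧
        IsGramBoundedR ((sectorSubMatrix L M β (bgmFatMultiplier L M klE0 β (nambuXiCT L μ (klFlowFrameU L M β U μ n)) (d * k - 1))).transpose * hubbardCovSliceCT L M β μ 0 (klFlowFrameU L M β U μ n) (klScale klE0 j) (klScale klE0 (d * k)) * sectorSubMatrix L M β (bgmFatMultiplier L M klE0 β (nambuXiCT L μ (klFlowFrameU L M β U μ n)) (d * k - 1))) (Real.sqrt (Cκ * (klScale klE0 (d * k) / klScale klE0 (d * k - 1)) * (klE0 * ((8 : ℝ) ^ (d * k - 1))⁻¹))) ∧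
        (∀ X, ∑ Y, ‖((sectorSubMatrix L M β (bgmFatMultiplier L M klE0 β (nambuXiCT L μ (klFlowFrameU L M β U μ n)) (d * k - 1))).transpose * hubbardCovSliceCT L M β μ 0 (klFlowFrameU L M β U μ n) (klScale klE0 j) (klScale klE0 (d * k)) * sectorSubMatrix L M β (bgmFatMultiplier L M klE0 β (nambuXiCT L μ (klFlowFrameU L M β U μ n)) (d * k - 1))) X Y‖ ≤ Cb * ((M : ℝ) / β) / klScale klE0 j) ∧
        (∀ Y, ∑ X, ‖((sectorSubMatrix L M β (bgmFatMultiplier L M klE0 β (nambuXiCT L μ (klFlowFrameU L M β U μ n)) (d * k - 1))).transpose * hubbardCovSliceCT L M β μ 0 (klFlowFrameU L M β U μ n) (klScale klE0 j) (klScale klE0 (d * k)) * sectorSubMatrix L M β (bgmFatMultiplier L M klE0 β (nambuXiCT L μ (klFlowFrameU L M β U μ n)) (d * k - 1))) X Y‖ ≤ Cb * ((M : ℝ) / β) / klScale klE0 j) ∧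
        Cb * ((M : ℝ) / β) / klScale klE0 j ≤ Cb * ((M : ℝ) / β) * (4 : ℝ) ^ d / klE0 * (4 : ℝ) ^ (d * k) ∧
        (∀ X'', ∑ X', ‖(sectorAnalysisMatrix L M β (klAnisoFamily L M β μ (klFlowFrameU L M β U μ n) klE0 (d * k)) * sectorSubMatrix L M β (bgmFatMultiplier L M klE0 β (nambuXiCT L μ (klFlowFrameU L M β U μ n)) (d * k - 1))) X'' X'‖ ≤ 81 * CJ * M / β) ∧
        (∀ X', ∑ X'', ‖(sectorAnalysisMatrix L M β (klAnisoFamily L M β μ (klFlowFrameU L M β U μ n) klE0 (d * k)) * sectorSubMatrix L M β (bgmFatMultiplier L M klE0 β (nambuXiCT L μ (klFlowFrameU L M β U μ n)) (d * k - 1))) X'' X'‖ ≤ 162 * CJ * M / β) := by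
  obtain ⟨Cκ, hCκ, hg⟩ := gram_sliceCT_bgmFat_sharp_klEng
  obtain ⟨Cb, hCb, hαp⟩ := TorusFourierL2.alphaWt_blockSliceCT_bgmFat_klEng_flow_all' d R c'' hc''
  obtain ⟨CJ, hCJ, hop⟩ := overlapWt_towerBlock_klEng_flow_all d R c'' hc''.le
  refine ⟨Cκ, Cb, CJ, hCκ, hCb, hCJ, ?_⟩
  intro G P Q c hP hR2 hc hc6 μ hμ U hU hU9 hcU β hβmin hβc L M _ _ hL3 hM3 n hn1 hnN hreg hhist hfr hosc k hk1 hdk hkN hkn j hj hjk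
  have he : (0 : ℝ) < klE0 := by norm_num [klE0]
  have hβ : 0 < β := KLRegimeSplit.pos_of_klBetaMin_le hβmin
  have hM0 : (0 : ℝ) < M := Nat.cast_pos.2 (Nat.pos_of_ne_zero (NeZero.ne M))
  have hU4 : U ≤ klEngU₀4 P R c := hU9.trans (klEngU₀9_le_klEngU₀4 P R c)
  have hU3g : U ≤ min (klEngU₀3 P R c) (1 / (R.Gfr 3 + 1)) :=
    le_min (hU9.trans (klEngU₀9_le_klEngU₀3 P R c)) (hU9.trans (klEngU₀9_le_inv_gfr_add_one P hR2.wf c (by norm_num)))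
  have hc3 : c ≤ klEngC₃3 P R := hc6.trans (klEngC₃6_le_klEngC₃3 P R)
  set K : TrigPolyC4v := klFlowFrameU L M β U μ n with hKdef
  have e1 : d * k - 1 + 1 = d * k := by omega
  have hmul : d * (k + 1) = d * k + d := Nat.mul_succ d k
  obtain ⟨hrow, hcol⟩ := hαp G P Q c hR2 hc hc6 μ hμ U hU hU3g hcU β hβmin hβc L M hL3 hM3 n hn1 hnN hreg hhist hosc (d * k - 1) (by omega) j
    (by omega) (by omega) (by omega) (d * k) (by omega)
  rw [e1] at hrow hcol
  obtain ⟨hrow', hcol'⟩ := hop G P Q c hR2 hc hc6 μ hμ U hU hU3g hcU β hβmin hβc L M hL3 hM3 n hn1 hnN hreg hhist hosc k (by omega) hkn (d * k) le_rfl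
  refine ⟨?_, ?_, ?_, ?_, ?_, ?_, ?_, ?_⟩
  · have h1 : 0 < klScale klE0 (d * k) := klth_klScale_pos _
    have h2 : 0 < klScale klE0 (d * k - 1) := klth_klScale_pos _
    exact Real.sqrt_pos.2 (by positivity)
  · rw [gramF_sq_mul_pow_eq hCκ.le (by omega)]
  · have hΛpos : 0 < klScale klE0 j := klth_klScale_pos _
    have hΛle : klScale klE0 j ≤ klScale klE0 (d * k) := klScale_le_klScale he.le hj
    have hΛle' : klScale klE0 (d * k) ≤ klScale klE0 (d * k - 1) := klScale_le_klScale he.le (by omega)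
    obtain ⟨m, hm⟩ : ∃ m, d * k - 1 = m + 1 := ⟨d * k - 2, by omega⟩
    have h := (hg P R c hP hR2 hc hc3 μ hμ U hU hU4 β hβmin hβc K hfr L M hL3 hM3 m (by omega)
      (klScale klE0 j) (klScale klE0 (d * k)) hΛpos hΛle (by rw [← hm]; exact hΛle')).2.1
    rw [← hm] at h
    exact h
  · exact fun X => sum_norm_le_of_sum_norm_mul_klScaleWt_le _ _ β (d * k) _ (hrow X)
  · exact fun Y => sum_norm_le_of_sum_norm_mul_klScaleWt_le _ _ β (d * k) _ (hcol Y)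
  · have hΛj : klScale klE0 (d * (k + 1)) ≤ klScale klE0 j := klScale_le_klScale he.le hjk
    have hpos : 0 < klScale klE0 (d * (k + 1)) := klth_klScale_pos _
    calc Cb * ((M : ℝ) / β) / klScale klE0 j ≤ Cb * ((M : ℝ) / β) / klScale klE0 (d * (k + 1)) :=
          div_le_div_of_nonneg_left (by positivity) hpos hΛj
      _ = _ := alphaF_eq_bound_mul_pow Cb _ d k
  · exact fun X'' => sum_norm_le_of_sum_norm_mul_klScaleWt_le _ _ β (d * k) _ (hrow' X'')
  · have h2 : (2 : ℝ) ^ (d * k - (d * k - 1)) = 2 := by rw [show d * k - (d * k - 1) = 1 by omega, pow_one]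
    intro X'
    have h := sum_norm_le_of_sum_norm_mul_klScaleWt_le _ _ β (d * k) _ (hcol' X')
    rw [h2] at h
    exact h.trans (le_of_eq (by ring))

/-! ## §2 The floor-keyed partial step with the block data discharged on the flow frame -/

/-- **THE FLOOR-KEYED STEP OF A PARTIAL BLOCK ON THE FLOW FRAME `K_n`, BLOCK DATA DISCHARGED** (RO-2, door side complete): under the v1 doors and an admissible
history at scale `n`, for every block `k ≥ 1` (`2 ≤ dk`, `d(k+1) ≤ n_β + 1`, `dk ≤ n`) and every `j` with `dk ≤ j ≤ d(k+1)`, with `Z^{K_n}_{Λ_{dk}} ≠ 0`, the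
k-free parameters pinned by equations (instantiate with `rfl`) to `κ̄ = √(2Cκe₀)`, `ᾱ = Cb·(M/β)·4^d/e₀`, `c̄r = 81·CJ·M/β`, `c̄c = 162·CJ·M/β`, and the guard of
`partialIncrLevF_le_kitStep_of_bounds`: its conclusion — the per-prescription floor norm of `𝒱_j − 𝒱_{dk}` at `F_{dk}` is at most the kit's literal step at
`W̄·Z̄^m·klTowerMuLevF … d k m` with `σ̄ τ̄ ψ̄ Φ̄` — the SAME array and parameters as the law's `hstep` (`levLawF_hstep_klEng[_tok]`).
[cite: BenfattoGiulianiMastropietro2006, §2.7 (2.71a), §2.8 (2.76)-(2.84), (2.97)-(2.98), §3 (3.2)-(3.8)] -/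
theorem partialIncrLevF_le_kitStep_klEng (d : ℕ) (R : RenConsts) (c'' : ℝ) (hc'' : 0 < c'') :
    ∃ Cκ Cb CJ : ℝ, 0 < Cκ ∧ 0 < Cb ∧ 0 < CJ ∧
      ∀ (G : GeoConsts) (P : SplitConsts) (Q : EngConsts) (c : ℝ), P.WF → R.WF2 → 0 < c → c ≤ klEngC₃6 P R →
      ∀ μ ∈ klWindowC, ∀ U : ℝ, 0 < U → U ≤ klEngU₀9 P R c → c'' * U ≤ 1 →
      ∀ β : ℝ, klBetaMin ≤ β → β ≤ Real.exp (c / U ^ 2) →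
      ∀ (L M : ℕ) [NeZero L] [NeZero M], klEngL₃ β U ≤ L → klEngM₃ β U L ≤ M →
      ∀ n : ℕ, 1 ≤ n → n ≤ nScales β + 1 → IsKLRegime U c (-(n : ℤ)) →
        HistP klPredsV17F2 L M G P Q R β U μ 0 n → FrameOK R U (nScales β) μ (klFlowFrameU L M β U μ n) →
        (∀ m, 1 ≤ m → m < n → FlowPieceOscAt L M c'' β U μ m) →
      1 ≤ d → ∀ k : ℕ, 1 ≤ k → 2 ≤ d * k → d * (k + 1) ≤ nScales β + 1 → d * k ≤ n → ∀ j : ℕ, d * k ≤ j → j ≤ d * (k + 1) →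
        hubbardEffPartitionFnCT L M β U μ 0 (klFlowFrameU L M β U μ n) (klScale klE0 (d * k)) ≠ 0 →
      ∀ D : ℕ, Fintype.card (SpaceTimeIdx L M × SectorLeg (sectorCount (d * k - 1))) / 2 ≤ D →
      ∀ κb αb crb ccb : ℝ, κb = Real.sqrt (2 * Cκ * klE0) → αb = Cb * ((M : ℝ) / β) * (4 : ℝ) ^ d / klE0 →
        crb = 81 * CJ * M / β → ccb = 162 * CJ * M / β →
      ∀ N : ℕ, 1 ≤ N →
        9 * αb * ccb / ((27 : ℝ) ^ 5 * exp 1 * κb ^ 2 * crb) *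
      towerV D (exp 2 * κb ^ 2 / ccb ^ 2)
        (fun m => 64 * (27 : ℝ) ^ 4 * exp 2 * crb / ccb * (exp 4 * ccb ^ 2 * imagTimeWeight β M ^ 2 / 8) ^ m * klTowerMuLevF L M β U μ (klFlowFrameU L M β U μ n) d k m) < 1 →
      ∀ (t : Fin 5) (q : ℕ) (Ωe : Fin (2 * q + 1 + 1) → Option (SectorLeg (sectorCount (d * k)))), levelCount Ωe = (t : ℕ) + 1 →
    klLevNormOf L M β μ (klFlowFrameU L M β U μ n) (d * k) (2 * q + 1 + 1) (klEffectiveAction L M β U μ (klFlowFrameU L M β U μ n) klE0 j -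
          klTowerInput L M β U μ (klFlowFrameU L M β U μ n) d k) Ωe /
        klLevUnitF β M t (q + 1) (d * k) ≤
      towerFO D (κb ^ 2 / (exp 4 * ccb ^ 2))
          (fun m => 64 * (27 : ℝ) ^ 4 * exp 2 * crb / ccb * (exp 4 * ccb ^ 2 * imagTimeWeight β M ^ 2 / 8) ^ m * klTowerMuLevF L M β U μ (klFlowFrameU L M β U μ n) d k m) (q + 1) +
        ∑ n' ∈ Icc 2 N, exp 1 * (9 * αb * ccb / ((27 : ℝ) ^ 5 * exp 1 * κb ^ 2 * crb)) ^ (n' - 1) * (exp 4 * ccb ^ 2 / κb ^ 2) ^ (q + 1) *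
          towerS D (exp 2 * κb ^ 2 / ccb ^ 2)
            (fun m => 64 * (27 : ℝ) ^ 4 * exp 2 * crb / ccb * (exp 4 * ccb ^ 2 * imagTimeWeight β M ^ 2 / 8) ^ m * klTowerMuLevF L M β U μ (klFlowFrameU L M β U μ n) d k m) n' (q + 1) +
        (exp 4 * ccb ^ 2 / κb ^ 2) ^ (q + 1) * exp 1 *
          towerV D (exp 2 * κb ^ 2 / ccb ^ 2)
            (fun m => 64 * (27 : ℝ) ^ 4 * exp 2 * crb / ccb * (exp 4 * ccb ^ 2 * imagTimeWeight β M ^ 2 / 8) ^ m * klTowerMuLevF L M β U μ (klFlowFrameU L M β U μ n) d k m) *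
          (9 * αb * ccb / ((27 : ℝ) ^ 5 * exp 1 * κb ^ 2 * crb) *
            towerV D (exp 2 * κb ^ 2 / ccb ^ 2)
              (fun m => 64 * (27 : ℝ) ^ 4 * exp 2 * crb / ccb * (exp 4 * ccb ^ 2 * imagTimeWeight β M ^ 2 / 8) ^ m * klTowerMuLevF L M β U μ (klFlowFrameU L M β U μ n) d k m)) ^ N /
          (1 - 9 * αb * ccb / ((27 : ℝ) ^ 5 * exp 1 * κb ^ 2 * crb) *
            towerV D (exp 2 * κb ^ 2 / ccb ^ 2)
              (fun m => 64 * (27 : ℝ) ^ 4 * exp 2 * crb / ccb * (exp 4 * ccb ^ 2 * imagTimeWeight β M ^ 2 / 8) ^ m * klTowerMuLevF L M β U μ (klFlowFrameU L M β U μ n) d k m)) := by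
  obtain ⟨Cκ, Cb, CJ, hCκ, hCb, hCJ, h⟩ := linkDataPartialF_klEng d R c'' hc''
  refine ⟨Cκ, Cb, CJ, hCκ, hCb, hCJ, ?_⟩
  intro G P Q c hP hR2 hc hc6 μ hμ U hU hU9 hcU β hβmin hβc L M _ _ hL3 hM3 n hn1 hnN hreg hhist hfr hosc hd k hk1 hdk hkN hkn j hj hjk hZ D hD
    κb αb crb ccb hκb hαb hcrb hccb N hN hguard t q Ωe hΩe
  have he : (0 : ℝ) < klE0 := by norm_num [klE0]
  have hβ : 0 < β := KLRegimeSplit.pos_of_klBetaMin_le hβmin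
  have hM0 : (0 : ℝ) < M := Nat.cast_pos.2 (Nat.pos_of_ne_zero (NeZero.ne M))
  obtain ⟨hκ0, hκκb, hGB, hrow, hcol, hαle, hrow', hcol'⟩ :=
    h G P Q c hP hR2 hc hc6 μ hμ U hU hU9 hcU β hβmin hβc L M hL3 hM3 n hn1 hnN hreg hhist hfr hosc k hk1 hdk hkN hkn j hj hjk
  have hκb0 : 0 < κb := by rw [hκb]; positivity
  have hαb0 : 0 < αb := by rw [hαb]; positivity
  have hcrb0 : 0 < crb := by rw [hcrb]; positivity
  have hccb0 : 0 < ccb := by rw [hccb]; positivity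
  subst hκb hαb hcrb hccb
  exact partialIncrLevF_le_kitStep_of_bounds hβ U μ _ hd hk1 hdk hj hZ hκ0 hκb0 hκκb hGB hαb0 hαle hrow hcol hcrb0 hccb0 hrow' hcol'
    hD hN hguard t q Ωe hΩe

/-! ## §3 The top-block forms: `j ≤ n_β + 1` in place of `d(k+1) ≤ n_β + 1` («(e′)-TOP-BLOCK», appended by k3c3-p2 g16 under the append protocol) -/

/-- **THE PARTIAL SLICE's DATA ON THE FLOW FRAME — TOP-BLOCK FORM** («(e′)-TOP-BLOCK», k3c3-p2 g16: the twin of `linkDataPartialF_klEng` with the binder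
`d·(k+1) ≤ n_β + 1` replaced by `j ≤ n_β + 1` — the only use of the former was the alpha door's `J₂ ≤ n_β + 1`; so the top partial block
`j ∈ [d·⌊(n_β+1)/d⌋, n_β+1]` is covered, and at `j = d(k+1)` it is still `linkDataF_klEng`'s tuple; ONE instance of this theorem supplies BOTH the law's per-block
link rows (`j := d(k+1)`) and the born partial step's slice rows under the SAME `Cκ Cb CJ`). Original docstring: **THE PARTIAL SLICE's DATA ON THE FLOW FRAME, FROM THE MODEL, AS ONE BUNDLE** — for every block `k ≥ 1` with `2 ≤ dk`, `d(k+1) ≤ n_β+1`, `dk ≤ n` and every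
`j` with `dk ≤ j ≤ d(k+1)`: the Gram constant `κ_k` of the fat-sandwiched partial slice `S(F̃_{dk−1})ᵀ C^{K_n}_{(Λ_j, Λ_{dk}]} S(F̃_{dk−1})` (positive, k-free form
`κ_k²·8^{dk} ≤ (√(2Cκe₀))²`, `IsGramBoundedR`), its UNWEIGHTED rows/cols `≤ α_j = Cb·(M/β)/Λ_j ≤ (Cb·(M/β)·4^d/e₀)·4^{dk}`, and the UNWEIGHTED analysis-overlap
rows/cols of `E(F_{dk})·S(F̃_{dk−1})` `≤ 81·CJ·M/β`, `≤ 162·CJ·M/β` — the statement of `linkDataF_klEng` with the partial slice (at `j = d(k+1)` verbatim).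
[cite: BenfattoGiulianiMastropietro2006, §2.7 (2.71a), §2.8 (2.77), (2.81)-(2.83)] -/
theorem linkDataPartialF_klEng' (d : ℕ) (R : RenConsts) (c'' : ℝ) (hc'' : 0 < c'') :
    ∃ Cκ Cb CJ : ℝ, 0 < Cκ ∧ 0 < Cb ∧ 0 < CJ ∧
      ∀ (G : GeoConsts) (P : SplitConsts) (Q : EngConsts) (c : ℝ), P.WF → R.WF2 → 0 < c → c ≤ klEngC₃6 P R →
      ∀ μ ∈ klWindowC, ∀ U : ℝ, 0 < U → U ≤ klEngU₀9 P R c → c'' * U ≤ 1 →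
      ∀ β : ℝ, klBetaMin ≤ β → β ≤ Real.exp (c / U ^ 2) →
      ∀ (L M : ℕ) [NeZero L] [NeZero M], klEngL₃ β U ≤ L → klEngM₃ β U L ≤ M →
      ∀ n : ℕ, 1 ≤ n → n ≤ nScales β + 1 → IsKLRegime U c (-(n : ℤ)) →
        HistP klPredsV17F2 L M G P Q R β U μ 0 n → FrameOK R U (nScales β) μ (klFlowFrameU L M β U μ n) →
        (∀ m, 1 ≤ m → m < n → FlowPieceOscAt L M c'' β U μ m) →
      ∀ k : ℕ, 1 ≤ k → 2 ≤ d * k → d * k ≤ n → ∀ j : ℕ, d * k ≤ j → j ≤ d * (k + 1) → j ≤ nScales β + 1 →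
        0 < Real.sqrt (Cκ * (klScale klE0 (d * k) / klScale klE0 (d * k - 1)) * (klE0 * ((8 : ℝ) ^ (d * k - 1))⁻¹)) ∧
        Real.sqrt (Cκ * (klScale klE0 (d * k) / klScale klE0 (d * k - 1)) * (klE0 * ((8 : ℝ) ^ (d * k - 1))⁻¹)) ^ 2 * (8 : ℝ) ^ (d * k) ≤ Real.sqrt (2 * Cκ * klE0) ^ 2 ∧
        IsGramBoundedR ((sectorSubMatrix L M β (bgmFatMultiplier L M klE0 β (nambuXiCT L μ (klFlowFrameU L M β U μ n)) (d * k - 1))).transpose * hubbardCovSliceCT L M β μ 0 (klFlowFrameU L M β U μ n) (klScale klE0 j) (klScale klE0 (d * k)) * sectorSubMatrix L M β (bgmFatMultiplier L M klE0 β (nambuXiCT L μ (klFlowFrameU L M β U μ n)) (d * k - 1))) (Real.sqrt (Cκ * (klScale klE0 (d * k) / klScale klE0 (d * k - 1)) * (klE0 * ((8 : ℝ) ^ (d * k - 1))⁻¹))) ∧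
        (∀ X, ∑ Y, ‖((sectorSubMatrix L M β (bgmFatMultiplier L M klE0 β (nambuXiCT L μ (klFlowFrameU L M β U μ n)) (d * k - 1))).transpose * hubbardCovSliceCT L M β μ 0 (klFlowFrameU L M β U μ n) (klScale klE0 j) (klScale klE0 (d * k)) * sectorSubMatrix L M β (bgmFatMultiplier L M klE0 β (nambuXiCT L μ (klFlowFrameU L M β U μ n)) (d * k - 1))) X Y‖ ≤ Cb * ((M : ℝ) / β) / klScale klE0 j) ∧
        (∀ Y, ∑ X, ‖((sectorSubMatrix L M β (bgmFatMultiplier L M klE0 β (nambuXiCT L μ (klFlowFrameU L M β U μ n)) (d * k - 1))).transpose * hubbardCovSliceCT L M β μ 0 (klFlowFrameU L M β U μ n) (klScale klE0 j) (klScale klE0 (d * k)) * sectorSubMatrix L M β (bgmFatMultiplier L M klE0 β (nambuXiCT L μ (klFlowFrameU L M β U μ n)) (d * k - 1))) X Y‖ ≤ Cb * ((M : ℝ) / β) / klScale klE0 j) ∧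
        Cb * ((M : ℝ) / β) / klScale klE0 j ≤ Cb * ((M : ℝ) / β) * (4 : ℝ) ^ d / klE0 * (4 : ℝ) ^ (d * k) ∧
        (∀ X'', ∑ X', ‖(sectorAnalysisMatrix L M β (klAnisoFamily L M β μ (klFlowFrameU L M β U μ n) klE0 (d * k)) * sectorSubMatrix L M β (bgmFatMultiplier L M klE0 β (nambuXiCT L μ (klFlowFrameU L M β U μ n)) (d * k - 1))) X'' X'‖ ≤ 81 * CJ * M / β) ∧
        (∀ X', ∑ X'', ‖(sectorAnalysisMatrix L M β (klAnisoFamily L M β μ (klFlowFrameU L M β U μ n) klE0 (d * k)) * sectorSubMatrix L M β (bgmFatMultiplier L M klE0 β (nambuXiCT L μ (klFlowFrameU L M β U μ n)) (d * k - 1))) X'' X'‖ ≤ 162 * CJ * M / β) := by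
  obtain ⟨Cκ, hCκ, hg⟩ := gram_sliceCT_bgmFat_sharp_klEng
  obtain ⟨Cb, hCb, hαp⟩ := TorusFourierL2.alphaWt_blockSliceCT_bgmFat_klEng_flow_all' d R c'' hc''
  obtain ⟨CJ, hCJ, hop⟩ := overlapWt_towerBlock_klEng_flow_all d R c'' hc''.le
  refine ⟨Cκ, Cb, CJ, hCκ, hCb, hCJ, ?_⟩
  intro G P Q c hP hR2 hc hc6 μ hμ U hU hU9 hcU β hβmin hβc L M _ _ hL3 hM3 n hn1 hnN hreg hhist hfr hosc k hk1 hdk hkn j hj hjk hkN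
  have he : (0 : ℝ) < klE0 := by norm_num [klE0]
  have hβ : 0 < β := KLRegimeSplit.pos_of_klBetaMin_le hβmin
  have hM0 : (0 : ℝ) < M := Nat.cast_pos.2 (Nat.pos_of_ne_zero (NeZero.ne M))
  have hU4 : U ≤ klEngU₀4 P R c := hU9.trans (klEngU₀9_le_klEngU₀4 P R c)
  have hU3g : U ≤ min (klEngU₀3 P R c) (1 / (R.Gfr 3 + 1)) :=
    le_min (hU9.trans (klEngU₀9_le_klEngU₀3 P R c)) (hU9.trans (klEngU₀9_le_inv_gfr_add_one P hR2.wf c (by norm_num)))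
  have hc3 : c ≤ klEngC₃3 P R := hc6.trans (klEngC₃6_le_klEngC₃3 P R)
  set K : TrigPolyC4v := klFlowFrameU L M β U μ n with hKdef
  have e1 : d * k - 1 + 1 = d * k := by omega
  have hmul : d * (k + 1) = d * k + d := Nat.mul_succ d k
  obtain ⟨hrow, hcol⟩ := hαp G P Q c hR2 hc hc6 μ hμ U hU hU3g hcU β hβmin hβc L M hL3 hM3 n hn1 hnN hreg hhist hosc (d * k - 1) (by omega) j
    (by omega) (by omega) (by omega) (d * k) (by omega)
  rw [e1] at hrow hcol
  obtain ⟨hrow', hcol'⟩ := hop G P Q c hR2 hc hc6 μ hμ U hU hU3g hcU β hβmin hβc L M hL3 hM3 n hn1 hnN hreg hhist hosc k (by omega) hkn (d * k) le_rfl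
  refine ⟨?_, ?_, ?_, ?_, ?_, ?_, ?_, ?_⟩
  · have h1 : 0 < klScale klE0 (d * k) := klth_klScale_pos _
    have h2 : 0 < klScale klE0 (d * k - 1) := klth_klScale_pos _
    exact Real.sqrt_pos.2 (by positivity)
  · rw [gramF_sq_mul_pow_eq hCκ.le (by omega)]
  · have hΛpos : 0 < klScale klE0 j := klth_klScale_pos _
    have hΛle : klScale klE0 j ≤ klScale klE0 (d * k) := klScale_le_klScale he.le hj
    have hΛle' : klScale klE0 (d * k) ≤ klScale klE0 (d * k - 1) := klScale_le_klScale he.le (by omega)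
    obtain ⟨m, hm⟩ : ∃ m, d * k - 1 = m + 1 := ⟨d * k - 2, by omega⟩
    have h := (hg P R c hP hR2 hc hc3 μ hμ U hU hU4 β hβmin hβc K hfr L M hL3 hM3 m (by omega)
      (klScale klE0 j) (klScale klE0 (d * k)) hΛpos hΛle (by rw [← hm]; exact hΛle')).2.1
    rw [← hm] at h
    exact h
  · exact fun X => sum_norm_le_of_sum_norm_mul_klScaleWt_le _ _ β (d * k) _ (hrow X)
  · exact fun Y => sum_norm_le_of_sum_norm_mul_klScaleWt_le _ _ β (d * k) _ (hcol Y)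
  · have hΛj : klScale klE0 (d * (k + 1)) ≤ klScale klE0 j := klScale_le_klScale he.le hjk
    have hpos : 0 < klScale klE0 (d * (k + 1)) := klth_klScale_pos _
    calc Cb * ((M : ℝ) / β) / klScale klE0 j ≤ Cb * ((M : ℝ) / β) / klScale klE0 (d * (k + 1)) :=
          div_le_div_of_nonneg_left (by positivity) hpos hΛj
      _ = _ := alphaF_eq_bound_mul_pow Cb _ d k
  · exact fun X'' => sum_norm_le_of_sum_norm_mul_klScaleWt_le _ _ β (d * k) _ (hrow' X'')
  · have h2 : (2 : ℝ) ^ (d * k - (d * k - 1)) = 2 := by rw [show d * k - (d * k - 1) = 1 by omega, pow_one]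
    intro X'
    have h := sum_norm_le_of_sum_norm_mul_klScaleWt_le _ _ β (d * k) _ (hcol' X')
    rw [h2] at h
    exact h.trans (le_of_eq (by ring))

/-- **THE FLOOR-KEYED STEP OF A PARTIAL BLOCK ON THE FLOW FRAME `K_n` — TOP-BLOCK FORM** («(e′)-TOP-BLOCK»: `partialIncrLevF_le_kitStep_klEng` with
`d·(k+1) ≤ n_β + 1` replaced by `j ≤ n_β + 1`, on `linkDataPartialF_klEng'`). Original docstring: **THE FLOOR-KEYED STEP OF A PARTIAL BLOCK ON THE FLOW FRAME `K_n`, BLOCK DATA DISCHARGED** (RO-2, door side complete): under the v1 doors and an admissible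
history at scale `n`, for every block `k ≥ 1` (`2 ≤ dk`, `d(k+1) ≤ n_β + 1`, `dk ≤ n`) and every `j` with `dk ≤ j ≤ d(k+1)`, with `Z^{K_n}_{Λ_{dk}} ≠ 0`, the
k-free parameters pinned by equations (instantiate with `rfl`) to `κ̄ = √(2Cκe₀)`, `ᾱ = Cb·(M/β)·4^d/e₀`, `c̄r = 81·CJ·M/β`, `c̄c = 162·CJ·M/β`, and the guard of
`partialIncrLevF_le_kitStep_of_bounds`: its conclusion — the per-prescription floor norm of `𝒱_j − 𝒱_{dk}` at `F_{dk}` is at most the kit's literal step at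
`W̄·Z̄^m·klTowerMuLevF … d k m` with `σ̄ τ̄ ψ̄ Φ̄` — the SAME array and parameters as the law's `hstep` (`levLawF_hstep_klEng[_tok]`).
[cite: BenfattoGiulianiMastropietro2006, §2.7 (2.71a), §2.8 (2.76)-(2.84), (2.97)-(2.98), §3 (3.2)-(3.8)] -/
theorem partialIncrLevF_le_kitStep_klEng' (d : ℕ) (R : RenConsts) (c'' : ℝ) (hc'' : 0 < c'') :
    ∃ Cκ Cb CJ : ℝ, 0 < Cκ ∧ 0 < Cb ∧ 0 < CJ ∧
      ∀ (G : GeoConsts) (P : SplitConsts) (Q : EngConsts) (c : ℝ), P.WF → R.WF2 → 0 < c → c ≤ klEngC₃6 P R →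
      ∀ μ ∈ klWindowC, ∀ U : ℝ, 0 < U → U ≤ klEngU₀9 P R c → c'' * U ≤ 1 →
      ∀ β : ℝ, klBetaMin ≤ β → β ≤ Real.exp (c / U ^ 2) →
      ∀ (L M : ℕ) [NeZero L] [NeZero M], klEngL₃ β U ≤ L → klEngM₃ β U L ≤ M →
      ∀ n : ℕ, 1 ≤ n → n ≤ nScales β + 1 → IsKLRegime U c (-(n : ℤ)) →
        HistP klPredsV17F2 L M G P Q R β U μ 0 n → FrameOK R U (nScales β) μ (klFlowFrameU L M β U μ n) →
        (∀ m, 1 ≤ m → m < n → FlowPieceOscAt L M c'' β U μ m) →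
      1 ≤ d → ∀ k : ℕ, 1 ≤ k → 2 ≤ d * k → d * k ≤ n → ∀ j : ℕ, d * k ≤ j → j ≤ d * (k + 1) → j ≤ nScales β + 1 →
        hubbardEffPartitionFnCT L M β U μ 0 (klFlowFrameU L M β U μ n) (klScale klE0 (d * k)) ≠ 0 →
      ∀ D : ℕ, Fintype.card (SpaceTimeIdx L M × SectorLeg (sectorCount (d * k - 1))) / 2 ≤ D →
      ∀ κb αb crb ccb : ℝ, κb = Real.sqrt (2 * Cκ * klE0) → αb = Cb * ((M : ℝ) / β) * (4 : ℝ) ^ d / klE0 →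
        crb = 81 * CJ * M / β → ccb = 162 * CJ * M / β →
      ∀ N : ℕ, 1 ≤ N →
        9 * αb * ccb / ((27 : ℝ) ^ 5 * exp 1 * κb ^ 2 * crb) *
      towerV D (exp 2 * κb ^ 2 / ccb ^ 2)
        (fun m => 64 * (27 : ℝ) ^ 4 * exp 2 * crb / ccb * (exp 4 * ccb ^ 2 * imagTimeWeight β M ^ 2 / 8) ^ m * klTowerMuLevF L M β U μ (klFlowFrameU L M β U μ n) d k m) < 1 →
      ∀ (t : Fin 5) (q : ℕ) (Ωe : Fin (2 * q + 1 + 1) → Option (SectorLeg (sectorCount (d * k)))), levelCount Ωe = (t : ℕ) + 1 →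
    klLevNormOf L M β μ (klFlowFrameU L M β U μ n) (d * k) (2 * q + 1 + 1) (klEffectiveAction L M β U μ (klFlowFrameU L M β U μ n) klE0 j -
          klTowerInput L M β U μ (klFlowFrameU L M β U μ n) d k) Ωe /
        klLevUnitF β M t (q + 1) (d * k) ≤
      towerFO D (κb ^ 2 / (exp 4 * ccb ^ 2))
          (fun m => 64 * (27 : ℝ) ^ 4 * exp 2 * crb / ccb * (exp 4 * ccb ^ 2 * imagTimeWeight β M ^ 2 / 8) ^ m * klTowerMuLevF L M β U μ (klFlowFrameU L M β U μ n) d k m) (q + 1) +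
        ∑ n' ∈ Icc 2 N, exp 1 * (9 * αb * ccb / ((27 : ℝ) ^ 5 * exp 1 * κb ^ 2 * crb)) ^ (n' - 1) * (exp 4 * ccb ^ 2 / κb ^ 2) ^ (q + 1) *
          towerS D (exp 2 * κb ^ 2 / ccb ^ 2)
            (fun m => 64 * (27 : ℝ) ^ 4 * exp 2 * crb / ccb * (exp 4 * ccb ^ 2 * imagTimeWeight β M ^ 2 / 8) ^ m * klTowerMuLevF L M β U μ (klFlowFrameU L M β U μ n) d k m) n' (q + 1) +
        (exp 4 * ccb ^ 2 / κb ^ 2) ^ (q + 1) * exp 1 *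
          towerV D (exp 2 * κb ^ 2 / ccb ^ 2)
            (fun m => 64 * (27 : ℝ) ^ 4 * exp 2 * crb / ccb * (exp 4 * ccb ^ 2 * imagTimeWeight β M ^ 2 / 8) ^ m * klTowerMuLevF L M β U μ (klFlowFrameU L M β U μ n) d k m) *
          (9 * αb * ccb / ((27 : ℝ) ^ 5 * exp 1 * κb ^ 2 * crb) *
            towerV D (exp 2 * κb ^ 2 / ccb ^ 2)
              (fun m => 64 * (27 : ℝ) ^ 4 * exp 2 * crb / ccb * (exp 4 * ccb ^ 2 * imagTimeWeight β M ^ 2 / 8) ^ m * klTowerMuLevF L M β U μ (klFlowFrameU L M β U μ n) d k m)) ^ N /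
          (1 - 9 * αb * ccb / ((27 : ℝ) ^ 5 * exp 1 * κb ^ 2 * crb) *
            towerV D (exp 2 * κb ^ 2 / ccb ^ 2)
              (fun m => 64 * (27 : ℝ) ^ 4 * exp 2 * crb / ccb * (exp 4 * ccb ^ 2 * imagTimeWeight β M ^ 2 / 8) ^ m * klTowerMuLevF L M β U μ (klFlowFrameU L M β U μ n) d k m)) := by
  obtain ⟨Cκ, Cb, CJ, hCκ, hCb, hCJ, h⟩ := linkDataPartialF_klEng' d R c'' hc''
  refine ⟨Cκ, Cb, CJ, hCκ, hCb, hCJ, ?_⟩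
  intro G P Q c hP hR2 hc hc6 μ hμ U hU hU9 hcU β hβmin hβc L M _ _ hL3 hM3 n hn1 hnN hreg hhist hfr hosc hd k hk1 hdk hkn j hj hjk hkN hZ D hD
    κb αb crb ccb hκb hαb hcrb hccb N hN hguard t q Ωe hΩe
  have he : (0 : ℝ) < klE0 := by norm_num [klE0]
  have hβ : 0 < β := KLRegimeSplit.pos_of_klBetaMin_le hβmin
  have hM0 : (0 : ℝ) < M := Nat.cast_pos.2 (Nat.pos_of_ne_zero (NeZero.ne M))
  obtain ⟨hκ0, hκκb, hGB, hrow, hcol, hαle, hrow', hcol'⟩ :=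
    h G P Q c hP hR2 hc hc6 μ hμ U hU hU9 hcU β hβmin hβc L M hL3 hM3 n hn1 hnN hreg hhist hfr hosc k hk1 hdk hkn j hj hjk hkN
  have hκb0 : 0 < κb := by rw [hκb]; positivity
  have hαb0 : 0 < αb := by rw [hαb]; positivity
  have hcrb0 : 0 < crb := by rw [hcrb]; positivity
  have hccb0 : 0 < ccb := by rw [hccb]; positivity
  subst hκb hαb hcrb hccb
  exact partialIncrLevF_le_kitStep_of_bounds hβ U μ _ hd hk1 hdk hj hZ hκ0 hκb0 hκκb hGB hαb0 hαle hrow hcol hcrb0 hccb0 hrow' hcol'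
    hD hN hguard t q Ωe hΩe

end Summit.HubbardSuperconductivity.HubbardSuperconductivity.Theorems.EngineV8

end
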